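import Summits.CriticalPhenomena.CardyFormulaZ2.Theses.CardyMagicRigidity
import HarnessLib

/-!
# Line `fair-coin-routing` for crux `NestingRigidity` (stmt-CriticalPhenomena-4835) — strategist skeleton s1 (2026-08-17)

ALTERNATIVE line (registered additively with `workitem stub-add`; the live skeleton `Lines/ring_cloud_tomography.lean` of seat
c3-0 is untouched).  It is the line form of the strategist DECOMPOSITION `NestingRigidity ⇐ BlindRigidity ∧ RoutingTransfer`
(the route-level `--split` is refused to a non-final seat; children + glue are certified in `StrategistSplit.lean` and
`children.json` is in the crux dir for the tenure planner / final-cycle lead):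

* `stub_blindRigidity`   : `MagicFormulaZ2 → MagicFormulaT → LoopLimitZ2Blind` — the crux's ORIGINAL open content, routing-free:
  the magic formulas force BLIND loop universality (DKKMO's coupling distance with `d(γ,γ') ≤ ε` replaced by "Hausdorff distance of
  the traces `≤ ε` and winding interiors `{W ≠ 0}` equal off the `ε`-neighbourhood of the traces").  Every landed module of the three
  earlier lines serves it (ring tomography ⇒ joint typed nesting laws ⇒ joint PGF uniqueness p130968 ⇒ tame precompactness ⇒ typed
  interior-preserving coupling p132016 ⇒ blind closeness via `FairCoinRouting.isBlindClose_of_isClose` + Tame).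
* `stub_routingTransfer` : `LoopLimitZ2Blind → LoopLimitZ2EqT` — the routing content isolated by route gap G4 (p132831/p133027),
  to be proved by FAIR-COIN ROUTING (crux idea `Ideas/fair-coin-routing.md`: hook-up bits are Bernoulli(1/2) with `P_{1/2}`-preserving
  flips fixing the 4-arm event on both lattices; 4-arm coupling property GPS arXiv:1008.1378 Prop. 11; routing-kernel lemma
  `SketchStrategist1.lean`).  Six-stub plan for its own skeleton in the idea card.

Both stubs are stated INLINE over Literature declarations and the route's decls (no new vocabulary is needed to prove them in a
Theorems file); `FairCoinRouting.loopLimitZ2Blind_iff` / `BlindRigidityStatement` /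
`RoutingTransferStatement` of `StrategistSplit.lean` name the two statements (not imported here to keep the skeleton self-contained).  `NestingRigidity_of` concludes the crux BY NAME;
sorries only inside the two `stub_*`.
-/

noncomputable section

namespace Summit.CriticalPhenomena.CardyFormulaZ2.Cruxes.NestingRigidity.FairCoinRoutingLine

open Summit.CriticalPhenomena.CardyFormulaZ2.Theses.CardyMagicRigidity

/-- STUB 1 (XL, open-problem grade — the crux's original content): the two magic formulas force BLIND loop universality
`ℤ² ~ 𝕋`.  Why plausibly true: it is implied by the crux (`blindRigidity_of_nestingRigidity`); intended proof = the blind chain of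
the three earlier lines (barrier to beat: NestingTransformBlindness — identities ⇒ interior LAWS needs non-crossing/Markov input). -/
theorem stub_blindRigidity :
    MagicFormulaZ2 → MagicFormulaT → Filter.Tendsto (fun δ : ℝ ↦ ⨅ (ε : ℝ) (_ : 0 < ε) (P : MeasureTheory.Measure (Literature.Probability.Percolation.BondConfig (Literature.Probability.LatticeModels.Site 2) × Literature.Probability.Percolation.SiteConfig (Literature.Probability.LatticeModels.Site 2))) (_ : P.map Prod.fst = Literature.Probability.Percolation.bondPercolation (Literature.Probability.LatticeModels.zdGraph 2) Literature.Probability.Percolation.half) (_ : P.map Prod.snd = Literature.Probability.LatticeModels.triSitePercolation Literature.Probability.Percolation.half) (_ : P {p | ¬ (∀ i : Fin 2, (∀ u ∈ (Literature.Probability.Percolation.bondLoopConfig δ 0 p.1).F i, u.range ⊆ Metric.ball (0 : ℂ) (1 / ε) → ∃ u' ∈ (⟨fun i ↦ {u : Literature.Probability.RandomPlanarGeometry.UnbasedLoop ℂ | ∃ (v : Literature.Probability.LatticeModels.HexVertex) (γ : Literature.Probability.LatticeModels.hexGraph.Walk v v), Literature.Probability.Percolation.IsSiteInterfaceLoop p.2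 γ ∧ (i = 1 ↔ 0 < Literature.Probability.Percolation.shoelace (γ.support.map Literature.Probability.LatticeModels.hexCenter)) ∧ u = Literature.Probability.RandomPlanarGeometry.UnbasedLoop.mk (Literature.Probability.RandomPlanarGeometry.BasedLoop.mk (Literature.Probability.Percolation.siteLoopCurve δ γ) (Literature.Probability.Percolation.isLoop_siteLoopCurve δ γ))}⟩ : Literature.Probability.RandomPlanarGeometry.LoopConfig ℂ).F i, Metric.hausdorffEDist u.range u'.range ≤ ENNReal.ofReal ε ∧ symmDiff {z : ℂ | u.wind z ≠ 0} {z : ℂ | u'.wind z ≠ 0} ⊆ Metric.cthickening ε (u.range ∪ u'.range)) ∧ (∀ u' ∈ (⟨fun i ↦ {u : Literature.Probability.RandomPlanarGeometry.UnbasedLoop ℂ | ∃ (v : Literature.Probability.LatticeModels.HexVertex) (γ : Literature.Probability.LatticeModels.hexGraph.Walk v v), Literature.Probability.Percolation.IsSiteInterfaceLoop p.2 γ ∧ (i = 1 ↔ 0 < Literature.Probability.Percolation.shoelace (γ.support.map Literature.Probability.LatticeModels.hexCenter)) ∧ u = Literature.Probability.RandomPlanarGeometry.UnbasedLoop.mk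 (Literature.Probability.RandomPlanarGeometry.BasedLoop.mk (Literature.Probability.Percolation.siteLoopCurve δ γ) (Literature.Probability.Percolation.isLoop_siteLoopCurve δ γ))}⟩ : Literature.Probability.RandomPlanarGeometry.LoopConfig ℂ).F i, u'.range ⊆ Metric.ball (0 : ℂ) (1 / ε) → ∃ u ∈ (Literature.Probability.Percolation.bondLoopConfig δ 0 p.1).F i, Metric.hausdorffEDist u'.range u.range ≤ ENNReal.ofReal ε ∧ symmDiff {z : ℂ | u'.wind z ≠ 0} {z : ℂ | u.wind z ≠ 0} ⊆ Metric.cthickening ε (u'.range ∪ u.range)))} < ENNReal.ofReal ε), ENNReal.ofReal ε) (nhdsWithin 0 (Set.Ioi 0)) (nhds 0) := by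
  sorry

/-- STUB 2 (L/XL, new lever FAIR-COIN ROUTING): blind loop universality upgrades to DKKMO's `d_CN` universality.  Why plausibly true:
on both lattices the hook-up at a pinch is a fair bit (one-variable flip, measure-preserving at `p = 1/2`, fixes the 4-arm event),
and 4-arm mixing (GPS Prop. 11) makes the routing word i.i.d. fair given the coarse arc system; so the conditional law of the loops
given the blind data is one lattice-independent kernel (`routingKernel`) and a blind coupling + shared bits is a `d_CN` coupling. -/
theorem stub_routingTransfer :
    (Filter.Tendsto (fun δ : ℝ ↦ ⨅ (ε : ℝ) (_ : 0 < ε) (P : MeasureTheory.Measure (Literature.Probability.Percolation.BondConfig (Literature.Probability.LatticeModels.Site 2) × Literature.Probability.Percolation.SiteConfig (Literature.Probability.LatticeModels.Site 2))) (_ : P.map Prod.fst = Literature.Probability.Percolation.bondPercolation (Literature.Probability.LatticeModels.zdGraph 2) Literature.Probability.Percolation.half) (_ : P.map Prod.snd = Literature.Probability.LatticeModels.triSitePercolation Literature.Probability.Percolation.half) (_ : P {p | ¬ (∀ i : Fin 2, (∀ u ∈ (Literature.Probability.Percolation.bondLoopConfig δ 0 p.1).F i, u.range ⊆ Metric.ball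 (0 : ℂ) (1 / ε) → ∃ u' ∈ (⟨fun i ↦ {u : Literature.Probability.RandomPlanarGeometry.UnbasedLoop ℂ | ∃ (v : Literature.Probability.LatticeModels.HexVertex) (γ : Literature.Probability.LatticeModels.hexGraph.Walk v v), Literature.Probability.Percolation.IsSiteInterfaceLoop p.2 γ ∧ (i = 1 ↔ 0 < Literature.Probability.Percolation.shoelace (γ.support.map Literature.Probability.LatticeModels.hexCenter)) ∧ u = Literature.Probability.RandomPlanarGeometry.UnbasedLoop.mk (Literature.Probability.RandomPlanarGeometry.BasedLoop.mk (Literature.Probability.Percolation.siteLoopCurve δ γ) (Literature.Probability.Percolation.isLoop_siteLoopCurve δ γ))}⟩ : Literature.Probability.RandomPlanarGeometry.LoopConfig ℂ).F i, Metric.hausdorffEDist u.range u'.range ≤ ENNReal.ofReal ε ∧ symmDiff {z : ℂ | u.wind z ≠ 0} {z : ℂ | u'.wind z ≠ 0} ⊆ Metric.cthickening ε (u.range ∪ u'.range)) ∧ (∀ u' ∈ (⟨fun i ↦ {u : Literature.Probability.RandomPlanarGeometry.UnbasedLoop ℂ | ∃ (v : Literature.Probability.LatticeModels.HexVertex) (γ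 : Literature.Probability.LatticeModels.hexGraph.Walk v v), Literature.Probability.Percolation.IsSiteInterfaceLoop p.2 γ ∧ (i = 1 ↔ 0 < Literature.Probability.Percolation.shoelace (γ.support.map Literature.Probability.LatticeModels.hexCenter)) ∧ u = Literature.Probability.RandomPlanarGeometry.UnbasedLoop.mk (Literature.Probability.RandomPlanarGeometry.BasedLoop.mk (Literature.Probability.Percolation.siteLoopCurve δ γ) (Literature.Probability.Percolation.isLoop_siteLoopCurve δ γ))}⟩ : Literature.Probability.RandomPlanarGeometry.LoopConfig ℂ).F i, u'.range ⊆ Metric.ball (0 : ℂ) (1 / ε) → ∃ u ∈ (Literature.Probability.Percolation.bondLoopConfig δ 0 p.1).F i, Metric.hausdorffEDist u'.range u.range ≤ ENNReal.ofReal ε ∧ symmDiff {z : ℂ | u'.wind z ≠ 0} {z : ℂ | u.wind z ≠ 0} ⊆ Metric.cthickening ε (u'.range ∪ u.range)))} < ENNReal.ofReal ε), ENNReal.ofReal ε) (nhdsWithin 0 (Set.Ioi 0)) (nhds 0)) → LoopLimitZ2EqT := by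
  sorry

/-- **Composition** (kernel-checked, no sorry of its own): the two stub statements imply the crux, by name. -/
theorem NestingRigidity_of_stubs :
    (MagicFormulaZ2 → MagicFormulaT → Filter.Tendsto (fun δ : ℝ ↦ ⨅ (ε : ℝ) (_ : 0 < ε) (P : MeasureTheory.Measure (Literature.Probability.Percolation.BondConfig (Literature.Probability.LatticeModels.Site 2) × Literature.Probability.Percolation.SiteConfig (Literature.Probability.LatticeModels.Site 2))) (_ : P.map Prod.fst = Literature.Probability.Percolation.bondPercolation (Literature.Probability.LatticeModels.zdGraph 2) Literature.Probability.Percolation.half) (_ : P.map Prod.snd = Literature.Probability.LatticeModels.triSitePercolation Literature.Probability.Percolation.half) (_ : P {p | ¬ (∀ i : Fin 2, (∀ u ∈ (Literature.Probability.Percolation.bondLoopConfig δ 0 p.1).F i, u.range ⊆ Metric.ball (0 : ℂ) (1 / ε) → ∃ u' ∈ (⟨fun i ↦ {u : Literature.Probability.RandomPlanarGeometry.UnbasedLoop ℂ | ∃ (v : Literature.Probability.LatticeModels.HexVertex) (γ : Literature.Probability.LatticeModels.hexGraph.Walk v v), Literature.Probability.Percolation.IsSiteInterfaceLoop p.2 γ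 ∧ (i = 1 ↔ 0 < Literature.Probability.Percolation.shoelace (γ.support.map Literature.Probability.LatticeModels.hexCenter)) ∧ u = Literature.Probability.RandomPlanarGeometry.UnbasedLoop.mk (Literature.Probability.RandomPlanarGeometry.BasedLoop.mk (Literature.Probability.Percolation.siteLoopCurve δ γ) (Literature.Probability.Percolation.isLoop_siteLoopCurve δ γ))}⟩ : Literature.Probability.RandomPlanarGeometry.LoopConfig ℂ).F i, Metric.hausdorffEDist u.range u'.range ≤ ENNReal.ofReal ε ∧ symmDiff {z : ℂ | u.wind z ≠ 0} {z : ℂ | u'.wind z ≠ 0} ⊆ Metric.cthickening ε (u.range ∪ u'.range)) ∧ (∀ u' ∈ (⟨fun i ↦ {u : Literature.Probability.RandomPlanarGeometry.UnbasedLoop ℂ | ∃ (v : Literature.Probability.LatticeModels.HexVertex) (γ : Literature.Probability.LatticeModels.hexGraph.Walk v v), Literature.Probability.Percolation.IsSiteInterfaceLoop p.2 γ ∧ (i = 1 ↔ 0 < Literature.Probability.Percolation.shoelace (γ.support.map Literature.Probability.LatticeModels.hexCenter)) ∧ u = Literature.Probability.RandomPlanarGeometry.UnbasedLoop.mk (Literature.Probability.RandomPlanarGeometry.BasedLoop.mk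 (Literature.Probability.Percolation.siteLoopCurve δ γ) (Literature.Probability.Percolation.isLoop_siteLoopCurve δ γ))}⟩ : Literature.Probability.RandomPlanarGeometry.LoopConfig ℂ).F i, u'.range ⊆ Metric.ball (0 : ℂ) (1 / ε) → ∃ u ∈ (Literature.Probability.Percolation.bondLoopConfig δ 0 p.1).F i, Metric.hausdorffEDist u'.range u.range ≤ ENNReal.ofReal ε ∧ symmDiff {z : ℂ | u'.wind z ≠ 0} {z : ℂ | u.wind z ≠ 0} ⊆ Metric.cthickening ε (u'.range ∪ u.range)))} < ENNReal.ofReal ε), ENNReal.ofReal ε) (nhdsWithin 0 (Set.Ioi 0)) (nhds 0)) → ((Filter.Tendsto (fun δ : ℝ ↦ ⨅ (ε : ℝ) (_ : 0 < ε) (P : MeasureTheory.Measure (Literature.Probability.Percolation.BondConfig (Literature.Probability.LatticeModels.Site 2) × Literature.Probability.Percolation.SiteConfig (Literature.Probability.LatticeModels.Site 2))) (_ : P.map Prod.fst = Literature.Probability.Percolation.bondPercolation (Literature.Probability.LatticeModels.zdGraph 2) Literature.Probability.Percolation.half) (_ : P.map Prod.snd = Literature.Probability.LatticeModels.triSitePercolation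 Literature.Probability.Percolation.half) (_ : P {p | ¬ (∀ i : Fin 2, (∀ u ∈ (Literature.Probability.Percolation.bondLoopConfig δ 0 p.1).F i, u.range ⊆ Metric.ball (0 : ℂ) (1 / ε) → ∃ u' ∈ (⟨fun i ↦ {u : Literature.Probability.RandomPlanarGeometry.UnbasedLoop ℂ | ∃ (v : Literature.Probability.LatticeModels.HexVertex) (γ : Literature.Probability.LatticeModels.hexGraph.Walk v v), Literature.Probability.Percolation.IsSiteInterfaceLoop p.2 γ ∧ (i = 1 ↔ 0 < Literature.Probability.Percolation.shoelace (γ.support.map Literature.Probability.LatticeModels.hexCenter)) ∧ u = Literature.Probability.RandomPlanarGeometry.UnbasedLoop.mk (Literature.Probability.RandomPlanarGeometry.BasedLoop.mk (Literature.Probability.Percolation.siteLoopCurve δ γ) (Literature.Probability.Percolation.isLoop_siteLoopCurve δ γ))}⟩ : Literature.Probability.RandomPlanarGeometry.LoopConfig ℂ).F i, Metric.hausdorffEDist u.range u'.range ≤ ENNReal.ofReal ε ∧ symmDiff {z : ℂ | u.wind z ≠ 0} {z : ℂ | u'.wind z ≠ 0} ⊆ Metric.cthickening ε (u.range ∪ u'.range))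 ∧ (∀ u' ∈ (⟨fun i ↦ {u : Literature.Probability.RandomPlanarGeometry.UnbasedLoop ℂ | ∃ (v : Literature.Probability.LatticeModels.HexVertex) (γ : Literature.Probability.LatticeModels.hexGraph.Walk v v), Literature.Probability.Percolation.IsSiteInterfaceLoop p.2 γ ∧ (i = 1 ↔ 0 < Literature.Probability.Percolation.shoelace (γ.support.map Literature.Probability.LatticeModels.hexCenter)) ∧ u = Literature.Probability.RandomPlanarGeometry.UnbasedLoop.mk (Literature.Probability.RandomPlanarGeometry.BasedLoop.mk (Literature.Probability.Percolation.siteLoopCurve δ γ) (Literature.Probability.Percolation.isLoop_siteLoopCurve δ γ))}⟩ : Literature.Probability.RandomPlanarGeometry.LoopConfig ℂ).F i, u'.range ⊆ Metric.ball (0 : ℂ) (1 / ε) → ∃ u ∈ (Literature.Probability.Percolation.bondLoopConfig δ 0 p.1).F i, Metric.hausdorffEDist u'.range u.range ≤ ENNReal.ofReal ε ∧ symmDiff {z : ℂ | u'.wind z ≠ 0} {z : ℂ | u.wind z ≠ 0} ⊆ Metric.cthickening ε (u'.range ∪ u.range)))} < ENNReal.ofReal ε), ENNReal.ofReal ε)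 (nhdsWithin 0 (Set.Ioi 0)) (nhds 0)) → LoopLimitZ2EqT) → NestingRigidity := by
  intro h₁ h₂ hZ hT
  exact h₂ (h₁ hZ hT)

/-- **The crux, by name**, modulo the two registered stubs. -/
theorem NestingRigidity_of : NestingRigidity :=
  NestingRigidity_of_stubs stub_blindRigidity stub_routingTransfer

end Summit.CriticalPhenomena.CardyFormulaZ2.Cruxes.NestingRigidity.FairCoinRoutingLine

end
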